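import Mathlib
import HarnessLib
import Summits.HubbardSuperconductivity.HubbardSuperconductivity.Theorems.ChiralWindowDefs
import Summits.HubbardSuperconductivity.HubbardSuperconductivity.Theorems.ChiralWindowCwKLChiralWindowHarmonicChannel
import Summits.HubbardSuperconductivity.HubbardSuperconductivity.Theorems.ChiralWindowCwKLChiralWindowFiniteMeasure
import Summits.HubbardSuperconductivity.HubbardSuperconductivity.Theorems.ChiralWindowCwKLChiralWindowGradient
import Summits.HubbardSuperconductivity.HubbardSuperconductivity.Theorems.ChiralWindowCwKLChiralWindowHausdorffFinite
import Literature.MathematicalPhysics.QuantumLattice.KohnLuttingerRadialProjection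

/-!
# Crux `CwKLChiralWindow` (stmt-1741), line `Sketch`: the trial functions of the certificate (`KLTrig`)

The certificate's trial and deflation functions are trigonometric polynomials of the polar angle (`KLTrig.toFun`,
`Theorems/ChiralWindowDefs.lean`).  This file proves the two facts the soundness of the checker needs:

* `stub_klTrigChannel` — if `t.fits χ` then `t.toFun` lies in the channel `χ` (pointwise identity `d4Project χ t.toFun = t.toFun`):
  harmonic by harmonic from `stub_klHarmonicChannel`, by linearity and induction over the coefficient lists;
* `kl_tr_toFun_memLp` — `t.toFun ∈ L²(σ_μ)` for `μ ∈ (-4,0)` (bounded by the `ℓ¹` norm of the coefficients, Borel measurable,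
  finite measure).
-/

noncomputable section

set_option linter.dupNamespace false

namespace Summit.HubbardSuperconductivity.HubbardSuperconductivity.Theorems

open MeasureTheory Literature.MathematicalPhysics.QuantumLattice CwKLChiralWindow

/-! ### Channel membership -/

/-- The zero function lies in every channel. [folklore] -/
theorem kl_tr_inChannel_zero (χ : D4Irrep) : InChannel χ (fun _ : Momentum => (0 : ℝ)) := by
  unfold InChannel d4Project
  funext k
  simp

open scoped Classical in
/-- Induction over a cosine coefficient list: if every frequency is admissible for `χ` (its harmonic lies in `χ`), the
truncated cosine polynomial (value `0` at the origin) lies in `χ`. [folklore] -/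
theorem kl_tr_inChannel_cosList (χ : D4Irrep) (L : List (ℕ × ℚ))
    (hL : ∀ p ∈ L, InChannel χ (fun k : Momentum => if k = 0 then 0 else Real.cos (p.1 * Complex.arg ⟨k 0, k 1⟩))) :
    InChannel χ (fun k : Momentum => if k = 0 then 0 else
      (L.map fun p : ℕ × ℚ => (p.2 : ℝ) * Real.cos ((p.1 : ℝ) * Complex.arg ⟨k 0, k 1⟩)).sum) := by
  induction L with
  | nil =>
    have : (fun k : Momentum => if k = 0 then (0 : ℝ) else
        (([] : List (ℕ × ℚ)).map fun p : ℕ × ℚ => (p.2 : ℝ) * Real.cos ((p.1 : ℝ) * Complex.arg ⟨k 0, k 1⟩)).sum) =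
        fun _ => 0 := by
      funext k; simp
    rw [this]; exact kl_tr_inChannel_zero χ
  | cons p L ih =>
    have hp := hL p (List.mem_cons_self)
    have ih' := ih fun q hq => hL q (List.mem_cons_of_mem _ hq)
    have hlin := kl_hc_inChannel_linear χ _ _ (p.2 : ℝ) 1 hp ih'
    have heq : (fun k : Momentum => if k = 0 then (0 : ℝ) else
        ((p :: L).map fun p : ℕ × ℚ => (p.2 : ℝ) * Real.cos ((p.1 : ℝ) * Complex.arg ⟨k 0, k 1⟩)).sum) =
        fun k => (p.2 : ℝ) * (if k = 0 then 0 else Real.cos (p.1 * Complex.arg ⟨k 0, k 1⟩)) +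
          1 * (if k = 0 then 0 else (L.map fun p : ℕ × ℚ => (p.2 : ℝ) * Real.cos ((p.1 : ℝ) * Complex.arg ⟨k 0, k 1⟩)).sum) := by
      funext k
      by_cases hk : k = 0
      · simp [hk]
      · simp [hk]
    rw [heq]; exact hlin

open scoped Classical in
/-- The same for a sine coefficient list. [folklore] -/
theorem kl_tr_inChannel_sinList (χ : D4Irrep) (L : List (ℕ × ℚ))
    (hL : ∀ p ∈ L, InChannel χ (fun k : Momentum => if k = 0 then 0 else Real.sin (p.1 * Complex.arg ⟨k 0, k 1⟩))) :
    InChannel χ (fun k : Momentum => if k = 0 then 0 else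
      (L.map fun p : ℕ × ℚ => (p.2 : ℝ) * Real.sin ((p.1 : ℝ) * Complex.arg ⟨k 0, k 1⟩)).sum) := by
  induction L with
  | nil =>
    have : (fun k : Momentum => if k = 0 then (0 : ℝ) else
        (([] : List (ℕ × ℚ)).map fun p : ℕ × ℚ => (p.2 : ℝ) * Real.sin ((p.1 : ℝ) * Complex.arg ⟨k 0, k 1⟩)).sum) =
        fun _ => 0 := by
      funext k; simp
    rw [this]; exact kl_tr_inChannel_zero χ
  | cons p L ih =>
    have hp := hL p (List.mem_cons_self)
    have ih' := ih fun q hq => hL q (List.mem_cons_of_mem _ hq)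
    have hlin := kl_hc_inChannel_linear χ _ _ (p.2 : ℝ) 1 hp ih'
    have heq : (fun k : Momentum => if k = 0 then (0 : ℝ) else
        ((p :: L).map fun p : ℕ × ℚ => (p.2 : ℝ) * Real.sin ((p.1 : ℝ) * Complex.arg ⟨k 0, k 1⟩)).sum) =
        fun k => (p.2 : ℝ) * (if k = 0 then 0 else Real.sin (p.1 * Complex.arg ⟨k 0, k 1⟩)) +
          1 * (if k = 0 then 0 else (L.map fun p : ℕ × ℚ => (p.2 : ℝ) * Real.sin ((p.1 : ℝ) * Complex.arg ⟨k 0, k 1⟩)).sum) := by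
      funext k
      by_cases hk : k = 0
      · simp [hk]
      · simp [hk]
    rw [heq]; exact hlin

open scoped Classical in
/-- `KLTrig.toFun` is the sum of its truncated cosine and sine parts. [folklore] -/
theorem kl_tr_toFun_eq (t : KLTrig) : t.toFun = fun k : Momentum =>
    1 * (if k = 0 then 0 else (t.cosC.map fun p : ℕ × ℚ => (p.2 : ℝ) * Real.cos ((p.1 : ℝ) * Complex.arg ⟨k 0, k 1⟩)).sum) +
    1 * (if k = 0 then 0 else (t.sinC.map fun p : ℕ × ℚ => (p.2 : ℝ) * Real.sin ((p.1 : ℝ) * Complex.arg ⟨k 0, k 1⟩)).sum) := by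
  funext k
  unfold KLTrig.toFun KLTrig.eval
  by_cases hk : k = 0
  · simp [hk]
  · simp [hk]

/-- **Trial functions lie in their channel** (`stub_klTrigChannel`): if the coefficient pattern `t.fits χ` holds then
`KLTrig.toFun t` is a channel-`χ` function. [folklore] -/
theorem stub_klTrigChannel : ∀ (t : KLTrig) (χ : D4Irrep), t.fits χ = true → InChannel χ t.toFun := by
  intro t χ hfit
  obtain ⟨hlin, hharm⟩ := stub_klHarmonicChannel
  rw [kl_tr_toFun_eq]
  refine hlin χ _ _ 1 1 (kl_tr_inChannel_cosList χ t.cosC ?_) (kl_tr_inChannel_sinList χ t.sinC ?_)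
  · intro p hp
    cases χ with
    | A1g =>
      simp only [KLTrig.fits, Bool.and_eq_true, List.all_eq_true, beq_iff_eq] at hfit
      exact (hharm p.1).1 (hfit.1 p hp)
    | A2g =>
      simp only [KLTrig.fits, Bool.and_eq_true, List.all_eq_true, List.isEmpty_iff] at hfit
      rw [hfit.2] at hp; exact absurd hp List.not_mem_nil
    | B1g =>
      simp only [KLTrig.fits, Bool.and_eq_true, List.all_eq_true, beq_iff_eq] at hfit
      exact (hharm p.1).2.2.1 (hfit.1 p hp)
    | B2g =>
      simp only [KLTrig.fits, Bool.and_eq_true, List.all_eq_true, List.isEmpty_iff] at hfit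
      rw [hfit.2] at hp; exact absurd hp List.not_mem_nil
    | E =>
      simp only [KLTrig.fits, Bool.and_eq_true, List.all_eq_true, beq_iff_eq] at hfit
      exact ((hharm p.1).2.2.2.2 (hfit.1 p hp)).1
  · intro p hp
    cases χ with
    | A1g =>
      simp only [KLTrig.fits, Bool.and_eq_true, List.all_eq_true, List.isEmpty_iff] at hfit
      rw [hfit.2] at hp; exact absurd hp List.not_mem_nil
    | A2g =>
      simp only [KLTrig.fits, Bool.and_eq_true, List.all_eq_true, beq_iff_eq] at hfit
      exact (hharm p.1).2.1 (hfit.1 p hp)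
    | B1g =>
      simp only [KLTrig.fits, Bool.and_eq_true, List.all_eq_true, List.isEmpty_iff] at hfit
      rw [hfit.2] at hp; exact absurd hp List.not_mem_nil
    | B2g =>
      simp only [KLTrig.fits, Bool.and_eq_true, List.all_eq_true, beq_iff_eq] at hfit
      exact (hharm p.1).2.2.2.1 (hfit.1 p hp)
    | E =>
      simp only [KLTrig.fits, Bool.and_eq_true, List.all_eq_true, beq_iff_eq] at hfit
      exact ((hharm p.1).2.2.2.2 (hfit.2 p hp)).2

/-! ### Square integrability -/

/-- A list of angle harmonics is bounded by the `ℓ¹` norm of its coefficients and continuous in the angle. [folklore] -/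
theorem kl_tr_eval_bound (t : KLTrig) (θ : ℝ) :
    |t.eval θ| ≤ (t.cosC.map fun p : ℕ × ℚ => |(p.2 : ℝ)|).sum + (t.sinC.map fun p : ℕ × ℚ => |(p.2 : ℝ)|).sum := by
  unfold KLTrig.eval
  have hc : ∀ L : List (ℕ × ℚ), |(L.map fun p : ℕ × ℚ => (p.2 : ℝ) * Real.cos ((p.1 : ℝ) * θ)).sum| ≤
      (L.map fun p : ℕ × ℚ => |(p.2 : ℝ)|).sum := by
    intro L
    induction L with
    | nil => simp
    | cons p L ih =>
      simp only [List.map_cons, List.sum_cons]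
      refine (abs_add_le _ _).trans (add_le_add ?_ ih)
      rw [abs_mul]
      exact mul_le_of_le_one_right (abs_nonneg _) (Real.abs_cos_le_one _)
  have hs : ∀ L : List (ℕ × ℚ), |(L.map fun p : ℕ × ℚ => (p.2 : ℝ) * Real.sin ((p.1 : ℝ) * θ)).sum| ≤
      (L.map fun p : ℕ × ℚ => |(p.2 : ℝ)|).sum := by
    intro L
    induction L with
    | nil => simp
    | cons p L ih =>
      simp only [List.map_cons, List.sum_cons]
      refine (abs_add_le _ _).trans (add_le_add ?_ ih)
      rw [abs_mul]
      exact mul_le_of_le_one_right (abs_nonneg _) (Real.abs_sin_le_one _)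
  exact (abs_add_le _ _).trans (add_le_add (hc _) (hs _))

/-- `θ ↦ t.eval θ` is continuous. [folklore] -/
theorem kl_tr_continuous_eval (t : KLTrig) : Continuous t.eval := by
  unfold KLTrig.eval
  have hc : ∀ L : List (ℕ × ℚ), Continuous fun θ : ℝ => (L.map fun p : ℕ × ℚ => (p.2 : ℝ) * Real.cos ((p.1 : ℝ) * θ)).sum := by
    intro L
    induction L with
    | nil => simpa using continuous_const
    | cons p L ih =>
      simp only [List.map_cons, List.sum_cons]
      exact (continuous_const.mul (Real.continuous_cos.comp (continuous_const.mul continuous_id))).add ih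
  have hs : ∀ L : List (ℕ × ℚ), Continuous fun θ : ℝ => (L.map fun p : ℕ × ℚ => (p.2 : ℝ) * Real.sin ((p.1 : ℝ) * θ)).sum := by
    intro L
    induction L with
    | nil => simpa using continuous_const
    | cons p L ih =>
      simp only [List.map_cons, List.sum_cons]
      exact (continuous_const.mul (Real.continuous_sin.comp (continuous_const.mul continuous_id))).add ih
  exact (hc _).add (hs _)

open scoped Classical in
/-- `KLTrig.toFun t` is Borel measurable. [folklore] -/
theorem kl_tr_measurable_toFun (t : KLTrig) : Measurable t.toFun := by
  unfold KLTrig.toFun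
  refine Measurable.ite (measurableSet_singleton 0) measurable_const ?_
  exact (kl_tr_continuous_eval t).measurable.comp (Complex.measurable_arg.comp continuous_complex_mk.measurable)

/-- **Trial functions are square integrable** on every window Fermi-curve measure. [folklore] -/
theorem kl_tr_toFun_memLp (t : KLTrig) {μ : ℝ} (hμ : μ ∈ Set.Ioo (-4 : ℝ) 0) :
    MemLp t.toFun 2 (fermiCurveMeasure (squareDispersion 1 0) μ) := by
  classical
  haveI : IsFiniteMeasure (fermiCurveMeasure (squareDispersion 1 0) μ) :=
    stub_klFiniteMeasure stub_klGradient stub_klHausdorffFinite μ hμ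
  refine MemLp.of_bound (kl_tr_measurable_toFun t).aestronglyMeasurable
    ((t.cosC.map fun p : ℕ × ℚ => |(p.2 : ℝ)|).sum + (t.sinC.map fun p : ℕ × ℚ => |(p.2 : ℝ)|).sum)
    (Filter.Eventually.of_forall fun k => ?_)
  rw [Real.norm_eq_abs]
  unfold KLTrig.toFun
  split_ifs with hk
  · rw [abs_zero]
    exact add_nonneg (List.sum_nonneg (by intro x hx; simp only [List.mem_map] at hx; obtain ⟨p, -, rfl⟩ := hx; exact abs_nonneg _))
      (List.sum_nonneg (by intro x hx; simp only [List.mem_map] at hx; obtain ⟨p, -, rfl⟩ := hx; exact abs_nonneg _))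
  · exact kl_tr_eval_bound t _

end Summit.HubbardSuperconductivity.HubbardSuperconductivity.Theorems

end
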